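import Mathlib
import Summits.PneNP.PneNP.Theorems.ConvexRankGatesLinAlgGateBlindDetNormalForm
import Summits.PneNP.PneNP.Theorems.ConvexRankGatesLinAlgGateBlindParallelSlots

/-!
# Route ConvexRankGates — crux `LinAlgGateBlind` (stmt-PneNP-10681), support:
# OR-closure of GRANK gate FUNCTIONS and the single-gate door for an arbitrary target

Two corollaries of `ConvexRankGatesLinAlgGateBlindParallelSlots.lean` (parallel positions act as
an OR, same field and dimension) and `ConvexRankGatesLinAlgGateBlindDetNormalForm.lean` (wiring
absorption over `Frac F[a]`; GRANK = DET):

* `isGRankGate_substOr_fn` — `GRANK ∘ OR ⊆ GRANK` as gate FUNCTIONS on the `N` inputs, without any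
  wiring: `x ↦ g (fun a => ⋁_{i ∈ S a} x_i)` is itself a GRANK gate of the same dimension (the
  explicit-wiring form `isGRankGate_substOr` followed by `isGRankGate_rewire`).
* `exists_hasDetRepr_shadow_of_grankGate_computes_fn` — for ANY Boolean function `f` on a finite
  input type `ι` (inputs enumerated by `Fintype.equivFin ι`): if one GRANK gate of dimension `≤ s`,
  wired arbitrarily to `ι`, computes `f`, then `f ≡ false` or `f` is the monotone shadow of a
  polynomial `P` over some field with `HasDetRepr P θ`, `θ ≤ s` (the clique case is
  `exists_hasDetRepr_shadow_of_grankGate_computes`).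

Def-free. [folklore]
-/

namespace Summit.PneNP.PneNP.Theorems

open Literature.Computability.Complexity MvPolynomial Matrix

/-- **`GRANK ∘ OR ⊆ GRANK` for gate functions (no wiring), same dimension.** If `g` is a GRANK gate
of dimension `≤ s` and position `a` is fed with the OR of the inputs `S a ⊆ Fin N`, then the
resulting Boolean function of the `N` inputs is a GRANK gate of dimension `≤ s` (over
`Frac F[a]`: parallel positions, then wiring absorption). [folklore] -/
theorem isGRankGate_substOr_fn : ∀ {s : ℕ} {g : GateFn}, IsGRankGate s g → ∀ {N : ℕ}
    (S : Fin g.1 → Finset (Fin N)),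
    IsGRankGate s ⟨N, fun x => g.2 fun a => decide (∃ i ∈ S a, x i = true)⟩ := by
  intro s g hg N S
  obtain ⟨g', w, hg', hw⟩ := isGRankGate_substOr hg S
  have h := isGRankGate_rewire hg' w
  have hfun : (fun x : Fin N → Bool => g'.2 fun j => x (w j)) =
      fun x => g.2 fun a => decide (∃ i ∈ S a, x i = true) := funext hw
  rw [hfun] at h
  exact h

/-- **The single-gate GRANK door for an arbitrary target function.** If ONE GRANK gate of dimension
`≤ s`, wired arbitrarily (`w`) to a finite input type `ι`, computes `f`, then either `f` is
identically false or there are a field `F`, `θ ≤ s` and a polynomial `P` in the input variables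
(enumerated by `Fintype.equivFin ι`) with an affine determinantal representation of size `θ`
whose monotone shadow is `f`. [folklore] -/
theorem exists_hasDetRepr_shadow_of_grankGate_computes_fn {ι : Type} [Fintype ι] {s : ℕ}
    {g : GateFn} (hg : IsGRankGate s g) (w : Fin g.1 → ι) (f : (ι → Bool) → Bool)
    (hcomp : ∀ x, g.2 (fun i => x (w i)) = f x) :
    (∀ x, f x = false) ∨ ∃ (F : Type) (_ : Field F) (θ : ℕ), θ ≤ s ∧
      ∃ P : MvPolynomial (Fin (Fintype.card ι)) F,
        Literature.Computability.AlgebraicComplexity.HasDetRepr P θ ∧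
        ∀ x : ι → Bool,
          (∃ t ∈ P.support, ∀ i ∈ t.support, x ((Fintype.equivFin ι).symm i) = true) ↔
            f x = true := by
  have hg' := isGRankGate_rewire hg (fun i => Fintype.equivFin ι (w i))
  rcases exists_det_shadow_of_isGRankGate hg' with h0 | ⟨F, _, θ, hθ, K₀, K, hK⟩
  · left
    intro x
    have h0' := h0 (fun j => x ((Fintype.equivFin ι).symm j))
    dsimp only at h0'
    simp only [Equiv.symm_apply_apply] at h0'
    rw [hcomp x] at h0'
    exact h0'
  · right
    refine ⟨F, inferInstance, θ, hθ, (symbolicPolyMatrix K₀ K).det,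
      ⟨symbolicPolyMatrix K₀ K, fun a b => totalDegree_symbolicPolyMatrix_le K₀ K a b, rfl⟩,
      fun x => ?_⟩
    have hK' := hK (fun j => x ((Fintype.equivFin ι).symm j))
    dsimp only at hK'
    simp only [Equiv.symm_apply_apply] at hK'
    rw [hcomp x] at hK'
    exact hK'.symm

end Summit.PneNP.PneNP.Theorems
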